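import Summits.AnomalousDissipation.AnomalousDissipation.Theorems.SawtoothPulseCascadeK1LocalisedCascadeCornerTraceGeomSum
import Summits.AnomalousDissipation.AnomalousDissipation.Theorems.SawtoothPulseCascadeK1LocalisedCascadeCornerTraceCount
import Mathlib.Analysis.Convex.Mul

/-!
# K1loc — helper: CLOSED FORMS FOR THE ALL-ORDERS CORNER-TRACE BOUND («CT-GEO» 3/4)

Helper file of the prover lane on the crux `K1LocalisedCascade` (stmt-AnomalousDissipation-19491), route
`SawtoothPulseCascade` (S-D fibre ledger, corner-trace track; finding F-p1g9-1, memo v15).  The scalar hypotheses of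
`…CornerTraceGeomSum.cornerTraceGeom_sum_sq_le` discharged in closed form for a symmetric interval window `|k| ≤ K`:
* §1 `convexOn_reflect_add_le`, `inv_pow_add_inv_pow_mono`: `1/(λ+k)^m + 1/(λ−k)^m` is non-decreasing in `k ∈ [0, λ)` (convexity of `x^{−m}`);
* §2 `sum_residueClass_Icc_le`: for `f` even, `≥ 0` and non-decreasing on `[0, K]`, every residue class `k ≡ ρ (N)` of `[−K, K]`
  carries at most `2f(K) + (1/N)Σ_{|m|≤K} f(m)`;
* §3 `geom_collapse_le`: `Σ_{i<p} Λ^i/a^{i+1} ≤ 1/(a−Λ)` (`0 ≤ Λ < a`); §4 `sum_Icc_edgeSq_le`: `Σ_{|m|≤K} 4λ′²/(λ′²−m²)² ≤ 8(K+½)/(λ′²−(K+½)²)`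
  (`λ′ ≥ K+1`, discrete telescoping of `4x/(λ′²−x²)`);
The assembled scalars (`τ_i` with `Σ_iτ_i ≤ 8λ′²/(λ′²−K²)² + 8(K+½)/(N(λ′²−(K+½)²))`, `σ_ξ`, `M_p`) are `…CornerTraceGeomTau`.
No definitions; nothing about the crux. [cite: Grafakos2014, Prop. 3.1.2 (5), §3.1.3] [problem: turb]
-/

-- `Summit.<Summit>.<Problem>`: single-conjunct summit, the duplicate namespace segment is deliberate.
set_option linter.dupNamespace false

noncomputable section

namespace Summit.AnomalousDissipation.AnomalousDissipation.Theorems.SawtoothPulseCascade.K1Window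

open Finset
open scoped Real

/-! ## §1 Monotonicity of `1/(λ+k)^m + 1/(λ−k)^m` on `[0, λ)` -/

/-- **Convexity under reflection**: for `f` convex on `s`, `x, y ∈ s`, `θ ∈ [0,1]`,
`f(θx + (1−θ)y) + f((1−θ)x + θy) ≤ f(x) + f(y)`. [folklore] -/
theorem convexOn_reflect_add_le {s : Set ℝ} {f : ℝ → ℝ} (hf : ConvexOn ℝ s f) {x y θ : ℝ} (hx : x ∈ s) (hy : y ∈ s)
    (h0 : 0 ≤ θ) (h1 : θ ≤ 1) :
    f (θ * x + (1 - θ) * y) + f ((1 - θ) * x + θ * y) ≤ f x + f y := by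
  have ha := hf.2 hx hy h0 (by linarith : 0 ≤ 1 - θ) (by ring)
  have hb := hf.2 hx hy (by linarith : 0 ≤ 1 - θ) h0 (by ring)
  simp only [smul_eq_mul] at ha hb
  linarith

/-- **`1/(λ+k)^m + 1/(λ−k)^m` is non-decreasing on `[0, λ)`**: for `0 ≤ k ≤ k′ < λ`,
`1/(λ+k)^m + 1/(λ−k)^m ≤ 1/(λ+k′)^m + 1/(λ−k′)^m` (convexity of `x ↦ x^{−m}` on `(0, ∞)`). [folklore] -/
theorem inv_pow_add_inv_pow_mono (m : ℕ) {lam k k' : ℝ} (hk : 0 ≤ k) (hkk' : k ≤ k') (hk' : k' < lam) :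
    1 / (lam + k) ^ m + 1 / (lam - k) ^ m ≤ 1 / (lam + k') ^ m + 1 / (lam - k') ^ m := by
  rcases eq_or_lt_of_le (le_trans hk hkk') with h0 | hpos
  · have : k = 0 := le_antisymm (h0 ▸ hkk') hk
    subst this; rw [← h0]
  have hconv := convexOn_zpow (𝕜 := ℝ) (-(m : ℤ))
  set θ : ℝ := (k' + k) / (2 * k') with hθ
  have hθ0 : 0 ≤ θ := by rw [hθ]; positivity
  have hθ1 : θ ≤ 1 := by rw [hθ, div_le_one (by positivity)]; linarith
  have hx : lam - k' ∈ Set.Ioi (0 : ℝ) := by simp only [Set.mem_Ioi]; linarith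
  have hy : lam + k' ∈ Set.Ioi (0 : ℝ) := by simp only [Set.mem_Ioi]; linarith
  have h := convexOn_reflect_add_le hconv hx hy hθ0 hθ1
  have e1 : θ * (lam - k') + (1 - θ) * (lam + k') = lam - k := by rw [hθ]; field_simp; ring
  have e2 : (1 - θ) * (lam - k') + θ * (lam + k') = lam + k := by rw [hθ]; field_simp; ring
  rw [e1, e2] at h
  simp only [zpow_neg, zpow_natCast, one_div] at h ⊢
  linarith

/-! ## §2 A residue class of `[−K, K]` carries at most `2f(K) + (1/N)Σf` -/

/-- One-sided version: for `f ≥ 0` non-decreasing on `[0, K]`, `0 ≤ A`, every residue class `k ≡ ρ (N)` of `[A, K]` carries at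
most `f(K) + (1/N)·Σ_{m∈[A,K]} f(m)` (all but at most one class point have the block `[k, k+N)` inside `[A, K]`). [folklore] -/
theorem sum_residueClass_Icc_le_oneSided (f : ℤ → ℝ) {K : ℤ} (hK : 0 ≤ K) (hf0 : ∀ k, 0 ≤ k → k ≤ K → 0 ≤ f k)
    (hmono : ∀ a b : ℤ, 0 ≤ a → a ≤ b → b ≤ K → f a ≤ f b) {N : ℕ} (hN : 0 < N) (ρ A : ℤ) (hA : 0 ≤ A) :
    ∑ k ∈ (Icc A K).filter (fun k => (N : ℤ) ∣ k - ρ), f k ≤ f K + 1 / N * ∑ m ∈ Icc A K, f m := by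
  classical
  have hNz : (0 : ℤ) < N := by exact_mod_cast hN
  have hNr : (0 : ℝ) < N := by exact_mod_cast hN
  set C := (Icc A K).filter (fun k => (N : ℤ) ∣ k - ρ) with hC
  have hCmem : ∀ k ∈ C, A ≤ k ∧ k ≤ K ∧ (N : ℤ) ∣ k - ρ := fun k hk => by
    obtain ⟨h1, h2⟩ := mem_filter.mp hk
    exact ⟨(mem_Icc.mp h1).1, (mem_Icc.mp h1).2, h2⟩
  -- split off the (at most one) top point
  rw [← sum_filter_add_sum_filter_not C (fun k => k + ((N : ℤ) - 1) ≤ K)]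
  set C₁ := C.filter (fun k => k + ((N : ℤ) - 1) ≤ K) with hC₁
  set C₂ := C.filter (fun k => ¬ k + ((N : ℤ) - 1) ≤ K) with hC₂
  have htop : ∑ k ∈ C₂, f k ≤ f K := by
    have hcard : C₂.card ≤ 1 := by
      refine Finset.card_le_one.mpr fun a ha b hb => ?_
      obtain ⟨haC, ha'⟩ := mem_filter.mp ha
      obtain ⟨hbC, hb'⟩ := mem_filter.mp hb
      obtain ⟨-, haK, hadvd⟩ := hCmem a haC
      obtain ⟨-, hbK, hbdvd⟩ := hCmem b hbC
      have hdvd : (N : ℤ) ∣ a - b := by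
        have := dvd_sub hadvd hbdvd; rwa [show a - ρ - (b - ρ) = a - b by ring] at this
      have habs : |a - b| < N := by rw [abs_lt]; constructor <;> omega
      have := Int.eq_zero_of_abs_lt_dvd hdvd habs
      omega
    calc ∑ k ∈ C₂, f k ≤ ∑ k ∈ C₂, f K := sum_le_sum fun k hk => by
            obtain ⟨hkC, -⟩ := mem_filter.mp hk
            obtain ⟨hAk, hkK, -⟩ := hCmem k hkC
            exact hmono k K (le_trans hA hAk) hkK le_rfl
      _ = C₂.card * f K := by rw [sum_const, nsmul_eq_mul]
      _ ≤ 1 * f K := mul_le_mul_of_nonneg_right (by exact_mod_cast hcard) (hf0 K hK le_rfl)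
      _ = f K := one_mul _
  -- the blocks of the other points
  have hblk : (N : ℝ) * ∑ k ∈ C₁, f k ≤ ∑ m ∈ Icc A K, f m := by
    have h1 : (N : ℝ) * ∑ k ∈ C₁, f k = ∑ k ∈ C₁, ∑ j ∈ range N, f k := by
      rw [mul_sum]
      refine sum_congr rfl fun k _ => ?_
      rw [sum_const, card_range, nsmul_eq_mul]
    have h2 : ∑ k ∈ C₁, ∑ j ∈ range N, f k ≤ ∑ k ∈ C₁, ∑ j ∈ range N, f (k + j) := by
      refine sum_le_sum fun k hk => sum_le_sum fun j hj => ?_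
      obtain ⟨hkC, hk'⟩ := mem_filter.mp hk
      obtain ⟨hAk, -, -⟩ := hCmem k hkC
      have hj' : (j : ℤ) < N := by exact_mod_cast mem_range.mp hj
      exact hmono k (k + j) (le_trans hA hAk) (by omega) (by omega)
    have h3 : ∑ k ∈ C₁, ∑ j ∈ range N, f (k + j) = ∑ x ∈ C₁ ×ˢ range N, f (x.1 + x.2) := by
      rw [sum_product]
    have hinj : Set.InjOn (fun x : ℤ × ℕ => x.1 + (x.2 : ℤ)) ↑(C₁ ×ˢ range N) := by
      intro x hx y hy hxy
      simp only [coe_product, Set.mem_prod, mem_coe] at hx hy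
      obtain ⟨hx1, hx2⟩ := hx
      obtain ⟨hy1, hy2⟩ := hy
      obtain ⟨-, -, hxd⟩ := hCmem x.1 (mem_filter.mp hx1).1
      obtain ⟨-, -, hyd⟩ := hCmem y.1 (mem_filter.mp hy1).1
      have hx2' : (x.2 : ℤ) < N := by exact_mod_cast mem_range.mp hx2
      have hy2' : (y.2 : ℤ) < N := by exact_mod_cast mem_range.mp hy2
      have hxy' : x.1 + (x.2 : ℤ) = y.1 + (y.2 : ℤ) := hxy
      have hdvd : (N : ℤ) ∣ x.1 - y.1 := by
        have := dvd_sub hxd hyd; rwa [show x.1 - ρ - (y.1 - ρ) = x.1 - y.1 by ring] at this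
      have habs : |x.1 - y.1| < N := by rw [abs_lt]; constructor <;> omega
      have h0 := Int.eq_zero_of_abs_lt_dvd hdvd habs
      have h1 : x.1 = y.1 := by omega
      have h2 : x.2 = y.2 := by omega
      exact Prod.ext h1 h2
    have h4 : ∑ x ∈ C₁ ×ˢ range N, f (x.1 + x.2) = ∑ m ∈ (C₁ ×ˢ range N).image (fun x : ℤ × ℕ => x.1 + (x.2 : ℤ)), f m := by
      rw [sum_image hinj]
    have h5 : (C₁ ×ˢ range N).image (fun x : ℤ × ℕ => x.1 + (x.2 : ℤ)) ⊆ Icc A K := by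
      intro m hm
      obtain ⟨x, hx, rfl⟩ := mem_image.mp hm
      obtain ⟨hx1, hx2⟩ := mem_product.mp hx
      obtain ⟨hx1C, hx1'⟩ := mem_filter.mp hx1
      obtain ⟨hAx, -, -⟩ := hCmem x.1 hx1C
      have hx2' : (x.2 : ℤ) < N := by exact_mod_cast mem_range.mp hx2
      exact mem_Icc.mpr ⟨by omega, by omega⟩
    rw [h1]
    refine h2.trans ?_
    rw [h3, h4]
    exact sum_le_sum_of_subset_of_nonneg h5 fun m hm _ => hf0 m (le_trans hA (mem_Icc.mp hm).1) (mem_Icc.mp hm).2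
  have hblk' : ∑ k ∈ C₁, f k ≤ 1 / N * ∑ m ∈ Icc A K, f m := by
    rw [one_div, inv_mul_eq_div, le_div_iff₀ hNr, mul_comm]; exact hblk
  linarith

/-- **A residue class of `[−K, K]`**: for `f ≥ 0`, even, non-decreasing on `[0, K]` (`K ≥ 0`), `N ≥ 1`, every `ρ`:
`Σ_{|k|≤K, k≡ρ (N)} f(k) ≤ 2f(K) + (1/N)Σ_{|m|≤K} f(m)`. [folklore] -/
theorem sum_residueClass_Icc_le (f : ℤ → ℝ) {K : ℤ} (hK : 0 ≤ K) (hf0 : ∀ k, 0 ≤ k → k ≤ K → 0 ≤ f k)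
    (heven : ∀ k, f (-k) = f k) (hmono : ∀ a b : ℤ, 0 ≤ a → a ≤ b → b ≤ K → f a ≤ f b) {N : ℕ} (hN : 0 < N) (ρ : ℤ) :
    ∑ k ∈ (Icc (-K) K).filter (fun k => (N : ℤ) ∣ k - ρ), f k ≤ 2 * f K + 1 / N * ∑ m ∈ Icc (-K) K, f m := by
  classical
  have hNr : (0 : ℝ) < N := by exact_mod_cast hN
  -- split `[−K, K] = [−K, −1] ∪ [0, K]`
  have hsplit : Icc (-K) K = Icc (-K) (-1) ∪ Icc 0 K := by
    ext k; simp only [mem_union, mem_Icc]; omega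
  have hdisj : Disjoint (Icc (-K) (-1)) (Icc (0 : ℤ) K) := by
    rw [disjoint_left]; intro k h1 h2; simp only [mem_Icc] at h1 h2; omega
  rw [hsplit, filter_union, sum_union (disjoint_filter_filter hdisj), sum_union hdisj]
  -- the nonnegative half
  have hpos := sum_residueClass_Icc_le_oneSided f hK hf0 hmono hN ρ 0 le_rfl
  -- the negative half, reflected
  have hneg : ∑ k ∈ (Icc (-K) (-1)).filter (fun k => (N : ℤ) ∣ k - ρ), f k ≤ f K + 1 / N * ∑ m ∈ Icc (-K) (-1), f m := by
    have e1 : ∑ k ∈ (Icc (-K) (-1)).filter (fun k => (N : ℤ) ∣ k - ρ), f k =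
        ∑ k ∈ (Icc 1 K).filter (fun k => (N : ℤ) ∣ k - (-ρ)), f k := by
      have himg : (Icc 1 K).filter (fun k => (N : ℤ) ∣ k - (-ρ)) =
          ((Icc (-K) (-1)).filter (fun k => (N : ℤ) ∣ k - ρ)).image (fun k => -k) := by
        ext k
        simp only [mem_filter, mem_Icc, mem_image]
        constructor
        · rintro ⟨⟨h1, h2⟩, h3⟩
          refine ⟨-k, ⟨⟨by omega, by omega⟩, ?_⟩, by ring⟩
          have := dvd_neg.mpr h3; rwa [show -(k - -ρ) = -k - ρ by ring] at this
        · rintro ⟨k', ⟨⟨h1, h2⟩, h3⟩, rfl⟩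
          refine ⟨⟨by omega, by omega⟩, ?_⟩
          have := dvd_neg.mpr h3; rwa [show -(k' - ρ) = -k' - -ρ by ring] at this
      rw [himg, sum_image (fun a _ b _ h => neg_injective h)]
      exact sum_congr rfl fun k _ => (heven k).symm
    have e2 : ∑ m ∈ Icc (-K) (-1), f m = ∑ m ∈ Icc 1 K, f m := by
      have himg : Icc (1 : ℤ) K = (Icc (-K) (-1)).image (fun k => -k) := by
        ext k; simp only [mem_Icc, mem_image]
        constructor
        · rintro ⟨h1, h2⟩; exact ⟨-k, ⟨by omega, by omega⟩, by ring⟩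
        · rintro ⟨k', ⟨h1, h2⟩, rfl⟩; exact ⟨by omega, by omega⟩
      rw [himg, sum_image (fun a _ b _ h => neg_injective h)]
      exact sum_congr rfl fun k _ => (heven k).symm
    rw [e1, e2]
    exact sum_residueClass_Icc_le_oneSided f hK hf0 hmono hN (-ρ) 1 zero_le_one
  have : 1 / (N : ℝ) * ∑ m ∈ Icc (-K) (-1), f m + 1 / N * ∑ m ∈ Icc 0 K, f m =
      1 / N * (∑ m ∈ Icc (-K) (-1), f m + ∑ m ∈ Icc 0 K, f m) := by ring
  linarith

/-! ## §3 The geometric collapse and the discrete telescoping -/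

/-- **Geometric collapse**: for `0 ≤ Λ < a`, `Σ_{i<p} Λ^i/a^{i+1} ≤ 1/(a − Λ)`. [folklore] -/
theorem geom_collapse_le (p : ℕ) {a Λ : ℝ} (hΛ : 0 ≤ Λ) (hΛa : Λ < a) :
    ∑ i ∈ range p, Λ ^ i / a ^ (i + 1) ≤ 1 / (a - Λ) := by
  have ha : 0 < a := lt_of_le_of_lt hΛ hΛa
  have haΛ : 0 < a - Λ := by linarith
  have htel : (a - Λ) * ∑ i ∈ range p, Λ ^ i / a ^ (i + 1) = 1 - (Λ / a) ^ p := by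
    induction p with
    | zero => simp
    | succ p ih =>
      rw [sum_range_succ, mul_add, ih, div_pow, div_pow]
      have hap : a ^ p ≠ 0 := pow_ne_zero _ ha.ne'
      have hap1 : a ^ (p + 1) ≠ 0 := pow_ne_zero _ ha.ne'
      field_simp
      ring
  rw [le_div_iff₀ haΛ, mul_comm, htel]
  have : 0 ≤ (Λ / a) ^ p := by positivity
  linarith

/-- **Discrete telescoping**: for `λ′ ≥ K + 1`, `K ≥ 0`: `Σ_{|m|≤K} 4λ′²/(λ′²−m²)² ≤ 8(K+½)/(λ′² − (K+½)²)`
(`4λ′²/(λ′²−m²)² ≤ G(m+½) − G(m−½)`, `G(x) = 4x/(λ′²−x²)`). [folklore] -/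
theorem sum_Icc_edgeSq_le {K : ℤ} (hK : 0 ≤ K) {lam' : ℝ} (hlam : (K : ℝ) + 1 ≤ lam') :
    ∑ m ∈ Icc (-K) K, 4 * lam' ^ 2 / (lam' ^ 2 - (m : ℝ) ^ 2) ^ 2 ≤
      8 * ((K : ℝ) + 1 / 2) / (lam' ^ 2 - ((K : ℝ) + 1 / 2) ^ 2) := by
  set G : ℝ → ℝ := fun x => 4 * x / (lam' ^ 2 - x ^ 2) with hG
  have hpt : ∀ m ∈ Icc (-K) K, 4 * lam' ^ 2 / (lam' ^ 2 - (m : ℝ) ^ 2) ^ 2 ≤ G ((m : ℝ) + 1 / 2) - G ((m : ℝ) - 1 / 2) := by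
    intro m hm
    obtain ⟨h1, h2⟩ := mem_Icc.mp hm
    have hm1 : (m : ℝ) ≤ K := by exact_mod_cast h2
    have hm2 : (-K : ℝ) ≤ m := by exact_mod_cast h1
    have habs0 : |(m : ℝ)| ≤ K := abs_le.mpr ⟨by linarith, hm1⟩
    have habs : |(m : ℝ)| + 1 ≤ lam' := by linarith
    have hd0 : 0 < lam' ^ 2 - (m : ℝ) ^ 2 := by nlinarith [abs_nonneg (m : ℝ), sq_abs (m : ℝ)]
    have hd1 : 0 < lam' ^ 2 - ((m : ℝ) + 1 / 2) ^ 2 := by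
      have := abs_le.mp (le_of_lt (lt_of_lt_of_le (lt_add_one _) habs))
      nlinarith [abs_nonneg (m : ℝ), sq_abs (m : ℝ), le_abs_self (m : ℝ), neg_abs_le (m : ℝ)]
    have hd2 : 0 < lam' ^ 2 - ((m : ℝ) - 1 / 2) ^ 2 := by
      nlinarith [abs_nonneg (m : ℝ), sq_abs (m : ℝ), le_abs_self (m : ℝ), neg_abs_le (m : ℝ)]
    simp only [hG]
    rw [div_sub_div _ _ hd1.ne' hd2.ne', div_le_div_iff₀ (by positivity) (mul_pos hd1 hd2)]
    -- polynomial inequality: with u = λ′² − m² ≥ 2|m| + 1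
    have hu : 2 * |(m : ℝ)| + 1 ≤ lam' ^ 2 - (m : ℝ) ^ 2 := by
      nlinarith [abs_nonneg (m : ℝ), sq_abs (m : ℝ)]
    nlinarith [sq_nonneg ((m : ℝ) * (lam' ^ 2 - (m : ℝ) ^ 2)), sq_nonneg (lam' ^ 2 - (m : ℝ) ^ 2), hd0, hu,
      abs_nonneg (m : ℝ), sq_abs (m : ℝ), sq_nonneg (m : ℝ), mul_pos hd1 hd2,
      mul_nonneg (mul_nonneg (sq_nonneg (m : ℝ)) hd0.le) hd0.le]
  refine (sum_le_sum hpt).trans ?_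
  -- telescoping over the integer interval
  have htel : ∀ n : ℕ, ∑ m ∈ Icc (-K) (-K + n), (G ((m : ℝ) + 1 / 2) - G ((m : ℝ) - 1 / 2)) =
      G ((-K : ℤ) + n + 1 / 2) - G ((-K : ℤ) - 1 / 2) := by
    intro n
    induction n with
    | zero => simp
    | succ n ih =>
      rw [show (-K + (n + 1 : ℕ) : ℤ) = (-K + n) + 1 by push_cast; ring, ← Finset.insert_Icc_right_eq_Icc_add_one (by omega),
        sum_insert (by simp only [mem_Icc]; omega), ih]
      push_cast
      ring
  have hKn : Icc (-K) K = Icc (-K) (-K + ((2 * K).toNat : ℕ)) := by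
    rw [Int.toNat_of_nonneg (by omega)]; congr 1; ring
  rw [hKn, htel]
  have e1 : ((-K : ℤ) : ℝ) + ((2 * K).toNat : ℕ) + 1 / 2 = (K : ℝ) + 1 / 2 := by
    have : (((2 * K).toNat : ℕ) : ℝ) = 2 * K := by exact_mod_cast Int.toNat_of_nonneg (by omega : 0 ≤ 2 * K)
    rw [this]; push_cast; ring
  have e2 : G ((-K : ℤ) - 1 / 2) = -G ((K : ℝ) + 1 / 2) := by simp only [hG]; push_cast; ring
  rw [e1, e2]
  simp only [hG]
  ring_nf
  rfl

end Summit.AnomalousDissipation.AnomalousDissipation.Theorems.SawtoothPulseCascade.K1Window
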